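import Mathlib
import Literature.MathematicalPhysics.QuantumFieldTheory.Balaban1983to89.B6
import Literature.MathematicalPhysics.QuantumFieldTheory.Balaban1983to89.B9

/-!
# `Balaban1983to89.B9FromB6` — the induction base of B9 imported from B6 = [4], entry by entry

B9 = T. Balaban, *Propagators for lattice gauge theories in a background field*, Commun. Math. Phys. **99**,
389–434 (1985) [Balaban1985BackgroundPropagators]; its reference [4] = B6 = T. Balaban, *Propagators and
renormalization transformations for lattice gauge theories. II*, Commun. Math. Phys. **96**, 223–250 (1984)
[Balaban1984PropagatorsII].

B9 p. 407 [PDF 19]: *"This allows us to prove Theorems 3.1–3.3 in some special situations, where we can use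
the results of [4]. There we have proved these theorems for operators with the external gauge field
configuration U = 1."*  In `B9.lean` this sentence is the by-reference LEAF `B9.BaseU1Printed`, feeding
`B9.cor35_of_sectB_base` and `B9.sectsAC_architecture`.  This module kernel-checks the EDGE

  `B6.Prop22Printed` ∧ `B6.Prop23Printed` ∧ `B6.Prop26Printed` + DICTIONARY + RESIDUAL ENTRIES + MODEL SIGNS
  ⟹ `B9.BaseU1Printed`                                                            (`baseU1_of_B6`)

so that exactly the entries WITHOUT a printed counterpart in [4] remain as named hypotheses (the table of the
cell census GAPS G-B9-03):
* `DictAtOne` — for each member of the family, the identification of the B9 quantities at U = 1 with the B6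
  quantities.  B9 p. 393 [PDF 5]: *"We refer the reader to the beginning of Sect. A of [4], especially to
  (2.1)–(2.4). The only change we make is that the sequence (2.1) starts with Ω₀ … The condition (2.2) is
  unchanged. We have introduced the domain Ω₀ because we will consider operators with Dirichlet boundary
  conditions on Ω₀ᶜ."*  That the propositions of [4] are available in this modified setting (they are printed
  for the setting of B6 Sect. 2; B6 p. 248 [PDF 26], after Prop. 2.6: *"Let us also repeat once more that this
  theorem holds for the operators G(Ω) with Dirichlet boundary conditions on Ωᶜ, Ω ⊃ Ω₁."* — "once more" = B6
  p. 228 [PDF 6] *"All the reasonings and the results of this paper hold, with minor and obvious changes, for the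
  operators G(Ω)."* (census G-B6-02); the restriction Ω ⊃ Ω₁ is met by B9's Ω₀ ⊃ Ω₁, p. 393) is asserted, not
  printed, for G′ and (Q′G′²Q′*)⁻¹ — GAPS G-A1-2; the dictionary is where that assertion lives.
* `ResidualGpAtOne` — the entries (3.43), (3.44), (3.45), (3.46), (3.47) for G′(1): [4] prints (2.67) = the
  entries (3.42) and the Hölder entries of (3.43) FOR CUT-OFFS SUPPORTED IN THE SMALL CUBE only (B6 p. 234:
  *"x ∈ B^j(y) or supp ζ ⊂ B^j(y), y ∈ Λ_j, supp λ ⊂ B^{j′}(y′)"*, whereas (3.43) p. 398 has *"ζ ∈ C₀^∞(Δ̃(y))"*,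
  the cube of size 2L^jη — revision v2, GAPS G-B9-20: the enlargement of the cut-off support is asserted by
  "proved in [4]", not printed; the printed small-cube case is kernel-derived separately, `gpH1Small_of_B6`);
  (3.44)–(3.47) have no counterpart in (2.67) at all (GAPS G-B9-03a, G-A1-1 (b)); for (3.47) B9 p. 398 says
  *"It is easy to see that the global inequalities (3.47) are consequences of the local ones (3.42) and Lemma 2.1."*
  (no derivation printed; note the print names the SUP entries (3.42) alone as the source of (3.47)).
* `ResidualGAGlobAtOne` — the global entries (3.47) for G(1) (same sentence).
* `ModelSigns` — sign and monotonicity facts of the lattice norms (3.39)–(3.41) of B9 (trivial in the model,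
  invisible to the abstract carriers).  They are what allows MERGING the constants of Props. 2.2, 2.6 and of
  the residual blocks into the single constant set of `B9.BaseU1Printed` (cf. DIVERGENCE D-b09.1), and they
  carry the one-line RANGE REPAIR of GAPS G-B9-13: B9 claims (3.44) for 0 < ε ≤ 1 and (3.45) for 0 ≤ β < 1,
  0 < ε ≤ 1, while B6 (2.138) has 0 < ε < 1 and (2.139) has α + ε < 1; since the Hölder quotient (3.40) is a
  sup over |x − x′| ≤ 1, ‖λ‖_{ε′} ≤ ‖λ‖_ε for ε′ ≤ ε (`ModelSigns.holder_mono`), and one applies (2.138) with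
  ε′ = ε/2, (2.139) with ε′ = min{ε, (1 − β)/2}.  This repair is NOT in print.

REVISION v2 (unit `b2b-balaban-b09` gen 2, with `B9.lean` v4; cell census G-ref1-7): `B9.Geometry` now separates
supp λ ⊂ Δ(y′) (`suppIn`) from supp λ ⊂ Δ̃(y′) (`suppInT`) and supp h ⊂ Δ(y) (`cutIn`) from ζ ∈ C₀^∞(Δ̃(y))
(`cutInT`), and `B9.Ineq343_345` carries the printed support sets.  Accordingly the entry blocks `H1Block`,
`E4Block`, `H2Block` below are re-typed, the dictionary gains the fields `suppT`, `cutT` (images of Δ̃-supported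
arguments / cut-offs), the (3.43)-entry of G′(1) moves to the residual (above), and the G(1) entries (3.43),
(3.44), (3.45) are imported from (2.137), (2.138), (2.139), whose printed support sets (B6 p. 247: *"ζ ∈
C₀^∞(Δ̃(y))"*, *"supp J ⊂ Δ̃(y′)"*) are exactly those of B9.  `B6.lean` itself still types ONE predicate per kind
(cell DIVERGENCE D-pv08.2, owner r1/b06): the soundness of `suppT`/`cutT` as set maps is exactly the soundness
of that typing of Prop. 2.6, see the `DictAtOne` docstring.

Value = typed skeleton + located gaps (the residual hypotheses are the gaps), NOT summit progress.
Cell pub-balaban: node T06.5 (Cor. 3.5), census ids G-B9-03, G-B9-03a, G-B9-13, G-B9-20, G-A1-1, G-A1-2, G-ref1-7.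
-/

namespace Literature.MathematicalPhysics.QuantumFieldTheory.Balaban1983to89.B9FromB6

/-! ## The six entry blocks of (3.42)–(3.47) for ONE configuration, separately -/

variable {g : B9.Geometry} {B : B9.Backgrounds}

/-- The sup entries (3.42): |(Gλ)(x)|, |(∇_U Gλ)(x)|, |(G∇*_U λ)(x)|, |(Δ_U Gλ)(x)| ≤ B₀[(L^jη)², L^jη, L^jη, 1]
e^{−δ₀d(y,y′)}|λ|. [cite: Balaban1985BackgroundPropagators, (3.42) p.397] -/
def EBlock (K : B9.KernelFamily g B) (B₀ δ₀ : ℝ) (U : B.Cfg) : Prop :=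
  ∀ (n : Fin 4) (lam : g.Loc) (y y' : g.Site), g.suppIn lam y' →
    K.e n U lam y ≤ B₀ * B9.pref4 (g.len y) n * Real.exp (-(δ₀ * g.dist y y')) * g.supNorm lam

/-- The L² entries (3.46). [cite: Balaban1985BackgroundPropagators, (3.46) p.398] -/
def L2Block (K : B9.KernelFamily g B) (B₀ δ₀ : ℝ) (U : B.Cfg) : Prop :=
  ∀ (n : Fin 6) (lam : g.Loc) (h : g.Cut) (y y' : g.Site), g.cutIn h y → g.suppIn lam y' →
    K.l2 n U lam h ≤ B₀ * B9.pref6 (g.len y) n * g.cutSup h * Real.exp (-(δ₀ * g.dist y y')) * g.l2Norm lam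

/-- The global entries (3.47) (γ in the fixed compact set [−4, 4] of `B9.Ineq342_346_347`). [cite: Balaban1985BackgroundPropagators, (3.47) p.398] -/
def GlobBlock (K : B9.KernelFamily g B) (B₀ : ℝ) (U : B.Cfg) : Prop :=
  ∀ (n : Fin 4) (lam : g.Loc) (γ : ℝ), -4 ≤ γ → γ ≤ 4 → K.glob n U lam γ ≤ B₀ * g.wNorm γ lam

/-- The Hölder entries (3.43): ‖ζ∇_U Gλ‖_β, ‖ζG∇*_U λ‖_β, *"for 0 ≤ β ≤ β₀ < 1, ζ ∈ C₀^∞(Δ̃(y)), y ∈ Λ_j,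
supp λ ⊂ Δ(y′)"* (`cutInT`, `suppIn` — revision v2). [cite: Balaban1985BackgroundPropagators, (3.43) p.398] -/
def H1Block (K : B9.KernelFamily g B) (Bβ : ℝ → ℝ) (δ₀ : ℝ) (U : B.Cfg) : Prop :=
  ∀ (β : ℝ) (lam : g.Loc) (ζ : g.Cut) (y y' : g.Site), 0 ≤ β → β < 1 → g.cutInT ζ y → g.suppIn lam y' →
    K.h1 U lam β ζ ≤ Bβ β * (g.len y) ^ (1 - β) * g.cutH β ζ * Real.exp (-(δ₀ * g.dist y y')) *
      g.supNorm lam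

/-- The Hölder entries of (3.43) for cut-offs supported in the SMALL cube Δ(y) = B^j(y) (`cutIn`): the shape
[4] prints at U = 1 for G′ in (2.67), p. 234 (*"x ∈ B^j(y) or supp ζ ⊂ B^j(y)"*) — a special case of `H1Block`
(`h1Block_restrict`); the converse enlargement is GAPS G-B9-20. [cite: Balaban1984PropagatorsII, (2.67) p.234] -/
def H1BlockSmall (K : B9.KernelFamily g B) (Bβ : ℝ → ℝ) (δ₀ : ℝ) (U : B.Cfg) : Prop :=
  ∀ (β : ℝ) (lam : g.Loc) (ζ : g.Cut) (y y' : g.Site), 0 ≤ β → β < 1 → g.cutIn ζ y → g.suppIn lam y' →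
    K.h1 U lam β ζ ≤ Bβ β * (g.len y) ^ (1 - β) * g.cutH β ζ * Real.exp (-(δ₀ * g.dist y y')) *
      g.supNorm lam

/-- (3.43) for Δ̃-cut-offs implies it for Δ-cut-offs (Δ(y) ⊂ Δ̃(y), a field of `B9.Geometry`). [folklore] -/
theorem h1Block_restrict (K : B9.KernelFamily g B) (Bβ : ℝ → ℝ) (δ₀ : ℝ) (U : B.Cfg)
    (h : H1Block K Bβ δ₀ U) : H1BlockSmall K Bβ δ₀ U :=
  fun β lam ζ y y' h0 h1 hζ hs => h β lam ζ y y' h0 h1 (g.cutInT_of_cutIn ζ y hζ) hs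

/-- The entry (3.44): |(∇_U G∇*_U λ)(x)| ≤ B′₀(ε)e^{−δ₀d(y,y′)}(‖λ‖_ε + |λ|), 0 < ε ≤ 1, *"x ∈ Δ(y), supp λ ⊂
Δ̃(y′)"* (`suppInT` — revision v2). [cite: Balaban1985BackgroundPropagators, (3.44) p.398] -/
def E4Block (K : B9.KernelFamily g B) (Bε : ℝ → ℝ) (δ₀ : ℝ) (U : B.Cfg) : Prop :=
  ∀ (ε : ℝ) (lam : g.Loc) (y y' : g.Site), 0 < ε → ε ≤ 1 → g.suppInT lam y' →
    K.e4 U lam y ≤ Bε ε * Real.exp (-(δ₀ * g.dist y y')) * (g.holder ε lam + g.supNorm lam)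

/-- The entry (3.45): ‖ζ∇_U G∇*_U λ‖_β ≤ B′₀(ε, β)(L^jη)^{−β}(…)e^{−δ₀d(y,y′)}(‖λ‖_{β+ε} + |λ|), 0 ≤ β < 1,
0 < ε ≤ 1, *"ζ ∈ C₀^∞(Δ̃(y)), … supp λ ⊂ Δ̃(y) [sic: Δ̃(y′), D-b09.8]"* (`cutInT`, `suppInT` — revision v2). [cite: Balaban1985BackgroundPropagators, (3.45) p.398] -/
def H2Block (K : B9.KernelFamily g B) (Bεβ : ℝ → ℝ → ℝ) (δ₀ : ℝ) (U : B.Cfg) : Prop :=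
  ∀ (ε β : ℝ) (lam : g.Loc) (ζ : g.Cut) (y y' : g.Site), 0 < ε → ε ≤ 1 → 0 ≤ β → β < 1 →
    g.cutInT ζ y → g.suppInT lam y' →
    K.h2 U lam β ζ ≤ Bεβ ε β * (g.len y) ^ (-β) * g.cutH β ζ * Real.exp (-(δ₀ * g.dist y y')) *
      (g.holder (β + ε) lam + g.supNorm lam)

/-- Bookkeeping: r1's block (3.42) + (3.46) + (3.47) is the conjunction of the three entry blocks. [folklore] -/
theorem ineq342_346_347_iff (K : B9.KernelFamily g B) (B₀ δ₀ : ℝ) (U : B.Cfg) :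
    B9.Ineq342_346_347 K B₀ δ₀ U ↔ EBlock K B₀ δ₀ U ∧ L2Block K B₀ δ₀ U ∧ GlobBlock K B₀ U := Iff.rfl

/-- Bookkeeping: r1's Hölder block (3.43)–(3.45) is the conjunction of the three entry blocks. [folklore] -/
theorem ineq343_345_iff (K : B9.KernelFamily g B) (Bβ Bε : ℝ → ℝ) (Bεβ : ℝ → ℝ → ℝ) (δ₀ : ℝ) (U : B.Cfg) :
    B9.Ineq343_345 K Bβ Bε Bεβ δ₀ U ↔ H1Block K Bβ δ₀ U ∧ E4Block K Bε δ₀ U ∧ H2Block K Bεβ δ₀ U :=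
  Iff.rfl

/-! ## Model sign facts of the norms (3.39)–(3.41) -/

/-- Sign and monotonicity facts of the lattice quantities entering (3.42)–(3.47), all evident for the norms
(3.39)–(3.41) of B9 (|λ| = sup of a Hilbert–Schmidt norm, ‖λ‖_ε = a sup of non-negative quotients over
|x − x′| ≤ 1 — hence non-decreasing in ε —, |λ|_{(γ)} a weighted sup, L ≥ 2, η > 0, d(y, y′) ≥ 0), but
invisible to the abstract carriers of `B9.lean`; recorded as explicit hypotheses of the edge theorem.
`holder_mono` is the one-line repair of GAPS G-B9-13. [folklore] -/
structure ModelSigns (g : B9.Geometry) : Prop where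
  L_nonneg : 0 ≤ g.L
  eta_nonneg : 0 ≤ g.eta
  dist_nonneg : ∀ y y' : g.Site, 0 ≤ g.dist y y'
  supNorm_nonneg : ∀ lam : g.Loc, 0 ≤ g.supNorm lam
  l2Norm_nonneg : ∀ lam : g.Loc, 0 ≤ g.l2Norm lam
  wNorm_nonneg : ∀ (γ : ℝ) (lam : g.Loc), 0 ≤ g.wNorm γ lam
  holder_nonneg : ∀ (ε : ℝ) (lam : g.Loc), 0 ≤ g.holder ε lam
  holder_mono : ∀ (ε ε' : ℝ) (lam : g.Loc), ε ≤ ε' → g.holder ε lam ≤ g.holder ε' lam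
  cutH_nonneg : ∀ (β : ℝ) (ζ : g.Cut), 0 ≤ g.cutH β ζ
  cutSup_nonneg : ∀ h : g.Cut, 0 ≤ g.cutSup h

/-- L^jη ≥ 0 under the model signs. [folklore] -/
theorem len_nonneg (S : ModelSigns g) (y : g.Site) : 0 ≤ g.len y :=
  show 0 ≤ g.L ^ g.scale y * g.eta from mul_nonneg (pow_nonneg S.L_nonneg _) S.eta_nonneg

/-- The prefactor vectors of B6 (2.67)/(2.140) and of B9 (3.42)/(3.46) are literally the same. [folklore] -/
theorem pref4_eq : B6.pref4 = B9.pref4 := rfl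

/-- see `pref4_eq` [folklore] -/
theorem pref6_eq : B6.pref6 = B9.pref6 := rfl

/-- [(L^jη)², L^jη, L^jη, 1] ≥ 0 entrywise for L^jη ≥ 0. [folklore] -/
theorem pref4_nonneg {t : ℝ} (ht : 0 ≤ t) : ∀ n : Fin 4, 0 ≤ B9.pref4 t n := by
  intro n
  fin_cases n
  · show 0 ≤ t ^ 2; positivity
  · show 0 ≤ t; exact ht
  · show 0 ≤ t; exact ht
  · show (0 : ℝ) ≤ 1; norm_num

/-- [(L^jη)², L^jη, L^jη, 1, 1, 1] ≥ 0 entrywise for L^jη ≥ 0. [folklore] -/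
theorem pref6_nonneg {t : ℝ} (ht : 0 ≤ t) : ∀ n : Fin 6, 0 ≤ B9.pref6 t n := by
  intro n
  fin_cases n
  · show 0 ≤ t ^ 2; positivity
  · show 0 ≤ t; exact ht
  · show 0 ≤ t; exact ht
  · show (0 : ℝ) ≤ 1; norm_num
  · show (0 : ℝ) ≤ 1; norm_num
  · show (0 : ℝ) ≤ 1; norm_num

/-! ## Weakening of constants and decay rates (the arithmetic of "with different constants") -/

/-- e^{−δd} ≤ e^{−δ′d} for δ′ ≤ δ and d ≥ 0. [folklore] -/
theorem decay_mono {δ δ' t : ℝ} (hδ : δ' ≤ δ) (ht : 0 ≤ t) :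
    Real.exp (-(δ * t)) ≤ Real.exp (-(δ' * t)) :=
  Real.exp_le_exp.mpr (neg_le_neg (mul_le_mul_of_nonneg_right hδ ht))

/-- Weakening for a bound of the shape q ≤ c·e^{−δd}·m. [folklore] -/
theorem weaken3 {q c c' δ δ' t m : ℝ} (h : q ≤ c * Real.exp (-(δ * t)) * m) (hc : c ≤ c') (hc' : 0 ≤ c')
    (hm : 0 ≤ m) (hδ : δ' ≤ δ) (ht : 0 ≤ t) : q ≤ c' * Real.exp (-(δ' * t)) * m := by
  refine h.trans ?_
  calc c * Real.exp (-(δ * t)) * m ≤ c' * Real.exp (-(δ * t)) * m :=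
        mul_le_mul_of_nonneg_right (mul_le_mul_of_nonneg_right hc (Real.exp_nonneg _)) hm
    _ ≤ c' * Real.exp (-(δ' * t)) * m :=
        mul_le_mul_of_nonneg_right (mul_le_mul_of_nonneg_left (decay_mono hδ ht) hc') hm

/-- Weakening for a bound of the shape q ≤ c·p·e^{−δd}·m. [folklore] -/
theorem weaken4 {q c c' p δ δ' t m : ℝ} (h : q ≤ c * p * Real.exp (-(δ * t)) * m) (hc : c ≤ c')
    (hc' : 0 ≤ c') (hp : 0 ≤ p) (hm : 0 ≤ m) (hδ : δ' ≤ δ) (ht : 0 ≤ t) :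
    q ≤ c' * p * Real.exp (-(δ' * t)) * m :=
  weaken3 (c := c * p) (c' := c' * p) h (mul_le_mul_of_nonneg_right hc hp) (mul_nonneg hc' hp) hm hδ ht

/-- Weakening for a bound of the shape q ≤ c·p₁·p₂·e^{−δd}·m. [folklore] -/
theorem weaken5 {q c c' p₁ p₂ δ δ' t m : ℝ} (h : q ≤ c * p₁ * p₂ * Real.exp (-(δ * t)) * m) (hc : c ≤ c')
    (hc' : 0 ≤ c') (hp₁ : 0 ≤ p₁) (hp₂ : 0 ≤ p₂) (hm : 0 ≤ m) (hδ : δ' ≤ δ) (ht : 0 ≤ t) :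
    q ≤ c' * p₁ * p₂ * Real.exp (-(δ' * t)) * m :=
  weaken3 (c := c * p₁ * p₂) (c' := c' * p₁ * p₂) h
    (mul_le_mul_of_nonneg_right (mul_le_mul_of_nonneg_right hc hp₁) hp₂)
    (mul_nonneg (mul_nonneg hc' hp₁) hp₂) hm hδ ht

/-! ## The dictionary at U = 1 and the residual entries -/

/-- **The dictionary B9 ↔ B6 at U = 1** for one member of the family: maps of coarse sites, localized
arguments and cut-offs from the B9 carriers to the B6 carriers preserving the geometry (L^jη, d(y, y′), M,
the support relations) and the norms, the geometric hypotheses (2.1)–(2.2) of [4] for the image (B9 p. 393: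
*"The only change we make is that the sequence (2.1) starts with Ω₀ … The condition (2.2) is unchanged"*),
and the identification of the operators at U = 1: the B9 quantities of G′(1) = (3.26) at U = 1, a = 1, of
(Q′G′(1)²Q′*)⁻¹ and of G(1) = (3.27) at U = 1 are BOUNDED BY the corresponding B6 quantities of G′ = Δ′_a⁻¹
(Prop. 2.2), (Q′G′²Q′*)⁻¹ (Prop. 2.3) and G (Prop. 2.6) (p. 407: *"There we have proved these theorems for
operators with the external gauge field configuration U = 1"*).  The availability of [4]'s propositions in
the Ω₀-Dirichlet setting of B9 is the content of these fields — asserted in print, GAPS G-A1-2; [4]'s own printed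
warrant is the blanket clause B6 p. 228 [PDF 6] *"All the reasonings and the results of this paper hold, with minor and
obvious changes, for the operators G(Ω)."* (census G-B6-02), repeated p. 248 after Prop. 2.6 *"… this theorem holds
for the operators G(Ω) with Dirichlet boundary conditions on Ωᶜ, Ω ⊃ Ω₁."* (Ω ⊃ Ω₁ is met by B9's Ω₀ ⊃ Ω₁, p. 393).
SUPPORT FIELDS (revision v2): `supp` / `suppT` send arguments with supp λ ⊂ Δ(y′) / supp λ ⊂ Δ̃(y′) of B9, and
`cutIn` / `cutT` send cut-offs with supp h ⊂ Δ(y) / ζ ∈ C₀^∞(Δ̃(y)) of B9, to arguments / cut-offs satisfying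
the ONE support predicate per kind that `B6.lean` types (`B6.Geometry.suppIn`, `.cutIn`, "supp ⊂ B^{j′}(y′) or
Δ(y′)/Δ̃(y′)").  As SET MAPS these four fields are sound exactly where [4] prints the same support set as B9 in
the clause the field feeds: `supp` ↦ (2.67), (2.136), (2.137), (2.140) [B^{j′}(y′) = Δ(y′) ✓]; `suppT` ↦ (2.138),
(2.139) [Δ̃(y′) ✓]; `cutIn` ↦ (2.140) [Δ(y) ✓]; `cutT` ↦ (2.137), (2.139) [Δ̃(y) ✓] — and NOT for `cutT` ↦ (2.67)
[B^j(y) printed, Δ̃(y) needed]: that clause is therefore not imported but residual (`ResidualGpAtOne`, GAPS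
G-B9-20).  That `B6.lean` lets one predicate stand for both cubes is cell DIVERGENCE D-pv08.2 (owner r1/b06);
when it splits, `supp`/`cutIn` target its Δ-predicates and `suppT`/`cutT` its Δ̃-predicates. [cite: Balaban1985BackgroundPropagators, p.393 + Cor. 3.5 proof p.407] -/
structure DictAtOne (g₆ : B6.Geometry) (g : B9.Geometry) (B : B9.Backgrounds) (Gp₆ : B6.GpFamily g₆)
    (C₆ : B6.SiteKernel g₆) (G₆ : B6.GFamily g₆) (Gp GA : B9.KernelFamily g B) (C : B9.SiteKernel g B) where
  site : g.Site → g₆.Site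
  loc : g.Loc → g₆.Loc
  cut : g.Cut → g₆.Cut
  hyp : g₆.Hyp21_22
  M_eq : g₆.M = g.M
  len_eq : ∀ y : g.Site, g₆.len (site y) = g.len y
  dist_eq : ∀ y y' : g.Site, g₆.dist (site y) (site y') = g.dist y y'
  supp : ∀ (lam : g.Loc) (y : g.Site), g.suppIn lam y → g₆.suppIn (loc lam) (site y)
  suppT : ∀ (lam : g.Loc) (y : g.Site), g.suppInT lam y → g₆.suppIn (loc lam) (site y)
  cutIn : ∀ (ζ : g.Cut) (y : g.Site), g.cutIn ζ y → g₆.cutIn (cut ζ) (site y)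
  cutT : ∀ (ζ : g.Cut) (y : g.Site), g.cutInT ζ y → g₆.cutIn (cut ζ) (site y)
  supNorm_eq : ∀ lam : g.Loc, g₆.supNorm (loc lam) = g.supNorm lam
  l2Norm_eq : ∀ lam : g.Loc, g₆.l2Norm (loc lam) = g.l2Norm lam
  holder_eq : ∀ (ε : ℝ) (lam : g.Loc), g₆.holder ε (loc lam) = g.holder ε lam
  cutH_eq : ∀ (β : ℝ) (ζ : g.Cut), g₆.cutH β (cut ζ) = g.cutH β ζ
  cutSup_eq : ∀ h : g.Cut, g₆.cutSup (cut h) = g.cutSup h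
  Gp_e : ∀ (n : Fin 4) (lam : g.Loc) (y : g.Site), Gp.e n B.one lam y ≤ Gp₆.e n (loc lam) (site y)
  Gp_h1 : ∀ (lam : g.Loc) (β : ℝ) (ζ : g.Cut), Gp.h1 B.one lam β ζ ≤ Gp₆.h1 (loc lam) β (cut ζ)
  C_ker : ∀ y y' : g.Site, |C.ker B.one y y'| ≤ |C₆.ker (site y) (site y')|
  GA_e : ∀ (n : Fin 4) (lam : g.Loc) (y : g.Site), GA.e n B.one lam y ≤ G₆.e n (loc lam) (site y)
  GA_h1 : ∀ (lam : g.Loc) (β : ℝ) (ζ : g.Cut), GA.h1 B.one lam β ζ ≤ G₆.h1 (loc lam) β (cut ζ)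
  GA_e4 : ∀ (lam : g.Loc) (y : g.Site), GA.e4 B.one lam y ≤ G₆.e4 (loc lam) (site y)
  GA_h2 : ∀ (lam : g.Loc) (β : ℝ) (ζ : g.Cut), GA.h2 B.one lam β ζ ≤ G₆.h2 (loc lam) β (cut ζ)
  GA_l2 : ∀ (n : Fin 6) (lam : g.Loc) (h : g.Cut), GA.l2 n B.one lam h ≤ G₆.l2 n (loc lam) (cut h)

/-- **Residual entries for G′(1)** — the part of "Theorems 3.1–3.3 at U = 1" that [4] does NOT print: the
Hölder entries (3.43) for cut-offs ζ ∈ C₀^∞(Δ̃(y)) (`H1Block`; [4] (2.67) prints them for supp ζ ⊂ B^j(y) only —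
GAPS G-B9-20, revision v2), the entries (3.44), (3.45) (`E4Block`, `H2Block`), (3.46) (`L2Block`) and (3.47)
(`GlobBlock`) for G′ = Δ′_a⁻¹ at U = 1, uniformly over the family for M ≥ M₁ (B6 Prop. 2.2 = (2.67) covers
(3.42) and the small-cube case of (3.43) only; B9 p. 398: *"It is easy to see that the global inequalities (3.47)
are consequences of the local ones (3.42) and Lemma 2.1."*).  GAPS G-B9-03a, G-A1-1 (b); not load-bearing downstream of B9 according to
G-B9-03a (B8 uses (3.47) entries of G, Sect. D uses (3.42)–(3.43) of G′ via (3.131)). [cite: Balaban1985BackgroundPropagators, Cor. 3.5 p.407 + (3.43)–(3.47) p.398] -/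
def ResidualGpAtOne {I : Type} (geo : I → B9.Geometry) (bg : I → B9.Backgrounds)
    (Gp : ∀ i, B9.KernelFamily (geo i) (bg i)) : Prop :=
  ∃ M₁ B₀ δ₀ : ℝ, ∃ Bβ Bε : ℝ → ℝ, ∃ Bεβ : ℝ → ℝ → ℝ, 0 < M₁ ∧ 0 < B₀ ∧ 0 < δ₀ ∧
    ∀ i : I, M₁ ≤ (geo i).M →
      L2Block (Gp i) B₀ δ₀ (bg i).one ∧ GlobBlock (Gp i) B₀ (bg i).one ∧ H1Block (Gp i) Bβ δ₀ (bg i).one ∧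
      E4Block (Gp i) Bε δ₀ (bg i).one ∧ H2Block (Gp i) Bεβ δ₀ (bg i).one

/-- **Residual entries for G(1)** — the global entries (3.47) for G at U = 1 (B6 Prop. 2.6 prints the local
and L² entries (2.136)–(2.140) = (3.42)–(3.46) only; B9 p. 398: *"It is easy to see that the global inequalities
(3.47) are consequences of the local ones (3.42) and Lemma 2.1."*, no derivation printed). [cite: Balaban1985BackgroundPropagators, (3.47) p.398 + Cor. 3.5 p.407] -/
def ResidualGAGlobAtOne {I : Type} (geo : I → B9.Geometry) (bg : I → B9.Backgrounds)
    (GA : ∀ i, B9.KernelFamily (geo i) (bg i)) : Prop :=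
  ∃ M₁ B₀ : ℝ, 0 < M₁ ∧ 0 < B₀ ∧ ∀ i : I, M₁ ≤ (geo i).M → GlobBlock (GA i) B₀ (bg i).one

/-- **What (2.67) prints of (3.43) at U = 1 for G′**, kernel-derived: the Hölder entries for cut-offs supported
in the small cube Δ(y) = B^j(y) (`H1BlockSmall`), uniformly over the family above the threshold of Prop. 2.2,
with decay rate ½δ₀ and constant max{C(β), 0}.  The Δ̃(y)-clause that (3.43) prints is NOT obtained this way
(GAPS G-B9-20) and stays in `ResidualGpAtOne`. [cite: Balaban1984PropagatorsII, Prop. 2.2 (2.67) p.234] -/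
theorem gpH1Small_of_B6 {I : Type} (geo₆ : I → B6.Geometry) (Gp₆ : ∀ i, B6.GpFamily (geo₆ i))
    (C₆ : ∀ i, B6.SiteKernel (geo₆ i)) (G₆ : ∀ i, B6.GFamily (geo₆ i))
    (geo : I → B9.Geometry) (bg : I → B9.Backgrounds) (Gp GA : ∀ i, B9.KernelFamily (geo i) (bg i))
    (C : ∀ i, B9.SiteKernel (geo i) (bg i))
    (D : ∀ i, DictAtOne (geo₆ i) (geo i) (bg i) (Gp₆ i) (C₆ i) (G₆ i) (Gp i) (GA i) (C i))
    (S : ∀ i, ModelSigns (geo i)) (h22 : B6.Prop22Printed geo₆ Gp₆) :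
    ∃ M₁ δ₀ : ℝ, ∃ Bβ : ℝ → ℝ, 0 < M₁ ∧ 0 < δ₀ ∧
      ∀ i : I, M₁ ≤ (geo i).M → H1BlockSmall (Gp i) Bβ δ₀ (bg i).one := by
  obtain ⟨M₂₂, δ₂₂, _C, Cα, hM22, hδ22, -, H22⟩ := h22
  refine ⟨M₂₂, δ₂₂ / 2, fun β => max (Cα β) 0, hM22, half_pos hδ22, ?_⟩
  intro i hM β lam ζ y y' hβ0 hβ1 hζ hs
  have hM₆ : M₂₂ ≤ (geo₆ i).M := by rw [(D i).M_eq]; exact hM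
  obtain ⟨-, P22h⟩ := H22 i (D i).hyp hM₆
  have h6 := P22h β ((D i).loc lam) ((D i).cut ζ) ((D i).site y) ((D i).site y') hβ0 hβ1
    ((D i).cutIn ζ y hζ) ((D i).supp lam y' hs)
  rw [(D i).len_eq, (D i).cutH_eq, (D i).dist_eq, (D i).supNorm_eq] at h6
  exact weaken5 (((D i).Gp_h1 lam β ζ).trans h6) (le_max_left _ _) (le_max_right _ _)
    (Real.rpow_nonneg (len_nonneg (S i) y) _) ((S i).cutH_nonneg β ζ) ((S i).supNorm_nonneg lam) le_rfl
    ((S i).dist_nonneg y y')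

/-! ## The edge theorem -/

/-- **The induction base of B9 from [4], kernel-checked** (B9 p. 407 [PDF 19]: *"we can use the results of
[4]. There we have proved these theorems for operators with the external gauge field configuration U = 1"*):
B6 Prop. 2.2 (2.67) gives the entries (3.42) of G′(1) (decay rate ½δ₀; its Hölder entries, printed for small-cube
cut-offs, give `gpH1Small_of_B6` and not the Δ̃-clause (3.43), which is residual — G-B9-20), Prop. 2.3 (2.87) gives (3.48)
(rate ½δ₁, kept as the separate pair (B₁, δ₁) of `B9.Thms31to33IneqAt`), Prop. 2.6 (2.136)–(2.140) gives
(3.42)–(3.46) of G(1) (rate δ₃) — through the dictionary `DictAtOne`; the remaining entries are the residual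
hypotheses `ResidualGpAtOne`, `ResidualGAGlobAtOne`; the constants are merged (B₀ = max, δ₀ = min,
M₁ = max of the thresholds, B₀(β) = max{C(β) of (2.137), residual, 0}, B′₀(ε) from C(ε/2), B′₀(ε, β) from C(β, min{ε, (1−β)/2}))
using `ModelSigns`, whose `holder_mono` performs the range repair of GAPS G-B9-13.  Conclusion: r1/b09's leaf
`B9.BaseU1Printed`, hence (with `B9.cor35_of_sectB_base`) Corollary 3.5 and the whole Sects. A–C
architecture `B9.sectsAC_architecture`. [cite: Balaban1985BackgroundPropagators, Cor. 3.5 proof p.407] -/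
theorem baseU1_of_B6 {I : Type} (d : ℕ) (geo₆ : I → B6.Geometry) (Gp₆ : ∀ i, B6.GpFamily (geo₆ i))
    (C₆ : ∀ i, B6.SiteKernel (geo₆ i)) (G₆ : ∀ i, B6.GFamily (geo₆ i))
    (geo : I → B9.Geometry) (bg : I → B9.Backgrounds) (Gp GA : ∀ i, B9.KernelFamily (geo i) (bg i))
    (C : ∀ i, B9.SiteKernel (geo i) (bg i))
    (D : ∀ i, DictAtOne (geo₆ i) (geo i) (bg i) (Gp₆ i) (C₆ i) (G₆ i) (Gp i) (GA i) (C i))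
    (S : ∀ i, ModelSigns (geo i))
    (h22 : B6.Prop22Printed geo₆ Gp₆) (h23 : B6.Prop23Printed d geo₆ C₆) (h26 : B6.Prop26Printed geo₆ G₆)
    (hGp : ResidualGpAtOne geo bg Gp) (hGA : ResidualGAGlobAtOne geo bg GA) :
    B9.BaseU1Printed d geo bg Gp GA C := by
  obtain ⟨M₂₂, δ₂₂, C₂₂, _Cα, hM22, hδ22, hC22, H22⟩ := h22
  obtain ⟨M₂₃, δ₂₃, C₂₃, hM23, hδ23, hC23, H23⟩ := h23
  obtain ⟨M₂₆, δ₃, C₂₆, Cα₂₆, Cε₂₆, Cαε₂₆, hM26, hδ3, hC26, H26⟩ := h26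
  obtain ⟨Ma, Ba, δa, Bβa, Bεa, Bεβa, hMa, hBa, hδa, Ha⟩ := hGp
  obtain ⟨Mb, Bb, hMb, hBb, Hb⟩ := hGA
  -- merged thresholds and constants, introduced together with the only facts used about them
  obtain ⟨M₁, hM₁pos, hM1, hM2, hM3, hM4, hM5⟩ :
      ∃ M₁ : ℝ, 0 < M₁ ∧ M₂₂ ≤ M₁ ∧ M₂₃ ≤ M₁ ∧ M₂₆ ≤ M₁ ∧ Ma ≤ M₁ ∧ Mb ≤ M₁ :=
    ⟨max (max (max M₂₂ M₂₃) (max M₂₆ Ma)) Mb, lt_of_lt_of_le hMb (le_max_right _ _),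
      le_max_of_le_left (le_max_of_le_left (le_max_left _ _)),
      le_max_of_le_left (le_max_of_le_left (le_max_right _ _)),
      le_max_of_le_left (le_max_of_le_right (le_max_left _ _)),
      le_max_of_le_left (le_max_of_le_right (le_max_right _ _)), le_max_right _ _⟩
  obtain ⟨B₀, hB₀pos, hB1, hB2, hB3, hB4⟩ :
      ∃ B₀ : ℝ, 0 < B₀ ∧ C₂₂ ≤ B₀ ∧ C₂₆ ≤ B₀ ∧ Ba ≤ B₀ ∧ Bb ≤ B₀ :=
    ⟨max (max C₂₂ C₂₆) (max Ba Bb), lt_of_lt_of_le hC22 (le_max_of_le_left (le_max_left _ _)),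
      le_max_of_le_left (le_max_left _ _), le_max_of_le_left (le_max_right _ _),
      le_max_of_le_right (le_max_left _ _), le_max_of_le_right (le_max_right _ _)⟩
  have hB₀nn : 0 ≤ B₀ := hB₀pos.le
  obtain ⟨δ₀, hδ₀pos, hδ1, hδ2, hδ3'⟩ : ∃ δ₀ : ℝ, 0 < δ₀ ∧ δ₀ ≤ δ₂₂ / 2 ∧ δ₀ ≤ δ₃ ∧ δ₀ ≤ δa :=
    ⟨min (min (δ₂₂ / 2) δ₃) δa, lt_min (lt_min (half_pos hδ22) hδ3) hδa,
      (min_le_left _ _).trans (min_le_left _ _), (min_le_left _ _).trans (min_le_right _ _),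
      min_le_right _ _⟩
  obtain ⟨Bβ, hBβ⟩ : ∃ Bβ : ℝ → ℝ, ∀ β, 0 ≤ Bβ β ∧ Bβa β ≤ Bβ β ∧ Cα₂₆ β ≤ Bβ β :=
    ⟨fun β => max (max (Bβa β) (Cα₂₆ β)) 0, fun β =>
      ⟨le_max_right _ _, le_max_of_le_left (le_max_left _ _), le_max_of_le_left (le_max_right _ _)⟩⟩
  obtain ⟨Bε, hBε⟩ : ∃ Bε : ℝ → ℝ, ∀ ε, 0 ≤ Bε ε ∧ Bεa ε ≤ Bε ε ∧ Cε₂₆ (ε / 2) ≤ Bε ε :=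
    ⟨fun ε => max (max (Bεa ε) (Cε₂₆ (ε / 2))) 0, fun ε =>
      ⟨le_max_right _ _, le_max_of_le_left (le_max_left _ _), le_max_of_le_left (le_max_right _ _)⟩⟩
  obtain ⟨Bεβ, hBεβ⟩ : ∃ Bεβ : ℝ → ℝ → ℝ, ∀ ε β, 0 ≤ Bεβ ε β ∧ Bεβa ε β ≤ Bεβ ε β ∧
      Cαε₂₆ β (min ε ((1 - β) / 2)) ≤ Bεβ ε β :=
    ⟨fun ε β => max (max (Bεβa ε β) (Cαε₂₆ β (min ε ((1 - β) / 2)))) 0, fun ε β =>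
      ⟨le_max_right _ _, le_max_of_le_left (le_max_left _ _), le_max_of_le_left (le_max_right _ _)⟩⟩
  refine ⟨M₁, B₀, δ₀, Bβ, Bε, Bεβ, C₂₃, δ₂₃ / 2, hM₁pos, hB₀pos, hδ₀pos, hC23, half_pos hδ23, ?_⟩
  intro i hM
  -- thresholds for the member i (M of B6 = M of B9 through the dictionary)
  have hM₆ : M₁ ≤ (geo₆ i).M := by rw [(D i).M_eq]; exact hM
  obtain ⟨P22e, -⟩ := H22 i (D i).hyp (hM1.trans hM₆)
  have P23 := H23 i (D i).hyp (hM2.trans hM₆)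
  obtain ⟨P26e, P26h1, P26e4, P26h2, P26l2⟩ := H26 i (D i).hyp (hM3.trans hM₆)
  obtain ⟨PaL2, PaGlob, PaH1, PaE4, PaH2⟩ := Ha i (hM4.trans hM)
  have Pb := Hb i (hM5.trans hM)
  have Sg := S i
  have hlen : ∀ y : (geo i).Site, 0 ≤ (geo i).len y := fun y => len_nonneg Sg y
  unfold B9.Thms31to33IneqAt B9.Ineq342_346_347 B9.Ineq343_345
  refine ⟨⟨⟨?_, ?_, ?_⟩, ⟨?_, ?_, ?_⟩⟩, ?_, ⟨⟨?_, ?_, ?_⟩, ⟨?_, ?_, ?_⟩⟩⟩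
  · -- (3.42) for G′(1) ⇐ B6 (2.67), entries 0–2 and 5
    intro n lam y y' hs
    have h6 := P22e n ((D i).loc lam) ((D i).site y) ((D i).site y') ((D i).supp lam y' hs)
    rw [(D i).len_eq, (D i).dist_eq, (D i).supNorm_eq, pref4_eq] at h6
    exact weaken4 (((D i).Gp_e n lam y).trans h6) hB1 hB₀nn (pref4_nonneg (hlen y) n)
      (Sg.supNorm_nonneg lam) hδ1 (Sg.dist_nonneg y y')
  · -- (3.46) for G′(1): residual
    intro n lam h y y' hh hs
    exact weaken5 (PaL2 n lam h y y' hh hs) hB3 hB₀nn (pref6_nonneg (hlen y) n) (Sg.cutSup_nonneg h)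
      (Sg.l2Norm_nonneg lam) hδ3' (Sg.dist_nonneg y y')
  · -- (3.47) for G′(1): residual
    intro n lam γ h1 h2
    exact (PaGlob n lam γ h1 h2).trans (mul_le_mul_of_nonneg_right hB3 (Sg.wNorm_nonneg γ lam))
  · -- (3.43) for G′(1), ζ ∈ C₀^∞(Δ̃(y)): residual (G-B9-20; the small-cube case of (2.67) is `gpH1Small_of_B6`)
    intro β lam ζ y y' hβ0 hβ1 hζ hs
    exact weaken5 (PaH1 β lam ζ y y' hβ0 hβ1 hζ hs) (hBβ β).2.1 (hBβ β).1 (Real.rpow_nonneg (hlen y) _)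
      (Sg.cutH_nonneg β ζ) (Sg.supNorm_nonneg lam) hδ3' (Sg.dist_nonneg y y')
  · -- (3.44) for G′(1): residual
    intro ε lam y y' hε0 hε1 hs
    exact weaken3 (PaE4 ε lam y y' hε0 hε1 hs) (hBε ε).2.1 (hBε ε).1
      (add_nonneg (Sg.holder_nonneg ε lam) (Sg.supNorm_nonneg lam)) hδ3' (Sg.dist_nonneg y y')
  · -- (3.45) for G′(1): residual
    intro ε β lam ζ y y' hε0 hε1 hβ0 hβ1 hζ hs
    exact weaken5 (PaH2 ε β lam ζ y y' hε0 hε1 hβ0 hβ1 hζ hs) (hBεβ ε β).2.1 (hBεβ ε β).1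
      (Real.rpow_nonneg (hlen y) _) (Sg.cutH_nonneg β ζ)
      (add_nonneg (Sg.holder_nonneg _ lam) (Sg.supNorm_nonneg lam)) hδ3' (Sg.dist_nonneg y y')
  · -- (3.48) at U = 1 ⇐ B6 (2.87)
    intro y y'
    have h6 := P23 ((D i).site y) ((D i).site y')
    rw [(D i).len_eq, (D i).len_eq, (D i).dist_eq] at h6
    exact ((D i).C_ker y y').trans h6
  · -- (3.42) for G(1) ⇐ B6 (2.136)
    intro n lam y y' hs
    have h6 := P26e n ((D i).loc lam) ((D i).site y) ((D i).site y') ((D i).supp lam y' hs)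
    rw [(D i).len_eq, (D i).dist_eq, (D i).supNorm_eq, pref4_eq] at h6
    exact weaken4 (((D i).GA_e n lam y).trans h6) hB2 hB₀nn (pref4_nonneg (hlen y) n)
      (Sg.supNorm_nonneg lam) hδ2 (Sg.dist_nonneg y y')
  · -- (3.46) for G(1) ⇐ B6 (2.140)
    intro n lam h y y' hh hs
    have h6 := P26l2 n ((D i).loc lam) ((D i).cut h) ((D i).site y) ((D i).site y')
      ((D i).cutIn h y hh) ((D i).supp lam y' hs)
    rw [(D i).len_eq, (D i).cutSup_eq, (D i).dist_eq, (D i).l2Norm_eq, pref6_eq] at h6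
    exact weaken5 (((D i).GA_l2 n lam h).trans h6) hB2 hB₀nn (pref6_nonneg (hlen y) n)
      (Sg.cutSup_nonneg h) (Sg.l2Norm_nonneg lam) hδ2 (Sg.dist_nonneg y y')
  · -- (3.47) for G(1): residual
    intro n lam γ h1 h2
    exact (Pb n lam γ h1 h2).trans (mul_le_mul_of_nonneg_right hB4 (Sg.wNorm_nonneg γ lam))
  · -- (3.43) for G(1) ⇐ B6 (2.137) (ζ ∈ C₀^∞(Δ̃(y)) ✓, supp λ ⊂ Δ(y′) ✓)
    intro β lam ζ y y' hβ0 hβ1 hζ hs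
    have h6 := P26h1 β ((D i).loc lam) ((D i).cut ζ) ((D i).site y) ((D i).site y') hβ0 hβ1
      ((D i).cutT ζ y hζ) ((D i).supp lam y' hs)
    rw [(D i).len_eq, (D i).cutH_eq, (D i).dist_eq, (D i).supNorm_eq] at h6
    exact weaken5 (((D i).GA_h1 lam β ζ).trans h6) (hBβ β).2.2 (hBβ β).1 (Real.rpow_nonneg (hlen y) _)
      (Sg.cutH_nonneg β ζ) (Sg.supNorm_nonneg lam) hδ2 (Sg.dist_nonneg y y')
  · -- (3.44) for G(1) ⇐ B6 (2.138) (supp λ ⊂ Δ̃(y′) ✓) at ε′ = ε/2 < 1 and ‖λ‖_{ε/2} ≤ ‖λ‖_ε (range repair G-B9-13)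
    intro ε lam y y' hε0 hε1 hs
    have hε' : 0 < ε / 2 := half_pos hε0
    have hε'1 : ε / 2 < 1 := by linarith
    have h6 := P26e4 (ε / 2) ((D i).loc lam) ((D i).site y) ((D i).site y') hε' hε'1
      ((D i).suppT lam y' hs)
    rw [(D i).dist_eq, (D i).holder_eq, (D i).supNorm_eq] at h6
    have h7 := weaken3 (((D i).GA_e4 lam y).trans h6) (hBε ε).2.2 (hBε ε).1
      (add_nonneg (Sg.holder_nonneg _ lam) (Sg.supNorm_nonneg lam)) hδ2 (Sg.dist_nonneg y y')
    refine h7.trans (mul_le_mul_of_nonneg_left (add_le_add (Sg.holder_mono _ _ lam ?_) le_rfl)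
      (mul_nonneg (hBε ε).1 (Real.exp_nonneg _)))
    linarith
  · -- (3.45) for G(1) ⇐ B6 (2.139) (Δ̃ ✓ ✓) at ε′ = min{ε, (1−β)/2} (β + ε′ < 1) and ‖λ‖_{β+ε′} ≤ ‖λ‖_{β+ε}
    intro ε β lam ζ y y' hε0 hε1 hβ0 hβ1 hζ hs
    have hε' : 0 < min ε ((1 - β) / 2) := lt_min hε0 (by linarith)
    have hle : min ε ((1 - β) / 2) ≤ ε := min_le_left _ _
    have hsum : β + min ε ((1 - β) / 2) < 1 := by
      have := min_le_right ε ((1 - β) / 2); linarith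
    have h6 := P26h2 β (min ε ((1 - β) / 2)) ((D i).loc lam) ((D i).cut ζ) ((D i).site y)
      ((D i).site y') hβ0 hε' hsum ((D i).cutT ζ y hζ) ((D i).suppT lam y' hs)
    rw [(D i).len_eq, (D i).cutH_eq, (D i).dist_eq, (D i).holder_eq, (D i).supNorm_eq] at h6
    have h7 := weaken5 (((D i).GA_h2 lam β ζ).trans h6) (hBεβ ε β).2.2 (hBεβ ε β).1
      (Real.rpow_nonneg (hlen y) _) (Sg.cutH_nonneg β ζ)
      (add_nonneg (Sg.holder_nonneg _ lam) (Sg.supNorm_nonneg lam)) hδ2 (Sg.dist_nonneg y y')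
    refine h7.trans (mul_le_mul_of_nonneg_left (add_le_add (Sg.holder_mono _ _ lam ?_) le_rfl)
      (mul_nonneg (mul_nonneg (mul_nonneg (hBεβ ε β).1 (Real.rpow_nonneg (hlen y) _))
        (Sg.cutH_nonneg β ζ)) (Real.exp_nonneg _)))
    linarith

/-- **Corollary 3.5 from [4] + Sect. B**, the edge composed with b09's `B9.cor35_of_sectB_base`: the printed
derivation of Cor. 3.5 (p. 407) with its [4]-import made explicit entry by entry. [cite: Balaban1985BackgroundPropagators, Cor. 3.5 p.407] -/
theorem cor35_of_B6 {I : Type} (d : ℕ) (c35 : ℝ) (geo₆ : I → B6.Geometry)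
    (Gp₆ : ∀ i, B6.GpFamily (geo₆ i)) (C₆ : ∀ i, B6.SiteKernel (geo₆ i)) (G₆ : ∀ i, B6.GFamily (geo₆ i))
    (geo : I → B9.Geometry) (bg : I → B9.Backgrounds) (Gp GA : ∀ i, B9.KernelFamily (geo i) (bg i))
    (C : ∀ i, B9.SiteKernel (geo i) (bg i))
    (IsAnalyticExt : ∀ i, B9.KernelFamily (geo i) (bg i) → (bg i).Cfg → ℝ → Prop)
    (D : ∀ i, DictAtOne (geo₆ i) (geo i) (bg i) (Gp₆ i) (C₆ i) (G₆ i) (Gp i) (GA i) (C i))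
    (S : ∀ i, ModelSigns (geo i))
    (h22 : B6.Prop22Printed geo₆ Gp₆) (h23 : B6.Prop23Printed d geo₆ C₆) (h26 : B6.Prop26Printed geo₆ G₆)
    (hGp : ResidualGpAtOne geo bg Gp) (hGA : ResidualGAGlobAtOne geo bg GA)
    (hone : ∀ i : I, ∀ α₀ : ℝ, 0 < α₀ → (bg i).Reg335 c35 α₀ (bg i).one)
    (hB : B9.SectBStepPrinted d c35 geo bg Gp GA C IsAnalyticExt) :
    B9.Cor35Printed d geo bg Gp GA C :=
  B9.cor35_of_sectB_base d c35 geo bg Gp GA C IsAnalyticExt hone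
    (baseU1_of_B6 d geo₆ Gp₆ C₆ G₆ geo bg Gp GA C D S h22 h23 h26 hGp hGA) hB

end Literature.MathematicalPhysics.QuantumFieldTheory.Balaban1983to89.B9FromB6
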